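import Summits.KontsevichZagierPeriods.KontsevichZagierPeriods.Theorems.SymplecticScissorsVolumeFormOffPlaneMixedSector

/-!
# `VolumeFormOffPlane` (stmt-KontsevichZagierPeriods-14935) — line `Sketch`,
stub `stub_simplexSector` (the mixed simplex/box sector in every dimension, bookkeeping)

Given (1) the divided power `simplex ~ box` in box-dimension `n + 1` (the log-simplex
`{a_ι < x_ι, ∏ x_ι < c, slack}` is KZ-equivalent to the log-box over `a` with edge ratios
`(γ, g, …, g)`, `g = c / ∏ a_ι`, `γ = g ^ (1 / (n + 1)!)`) and (2) the rank-two toric box sector in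
real-algebraic position (every box-dimension), two MIXED finite families of log-boxes and
log-simplices in total dimension `n + 2` with equal total value are KZ-equivalent as formal sums.

Proof: replace every simplex `S_ν` by its box `B_ν` (it exists by `stub_logBoxCut.1`; (1) gives
`[S_ν] − [B_ν] ∈ relations`, so the values agree by soundness of the calculus); with
`c_ν = (∏ a_ν) · αᵘ βᵛ` the edge ratios of `B_ν` are `g = αᵘ βᵛ` in every coordinate but the
first, where it is `g ^ (1 / (n + 1)!) = α^{u / (n + 1)!} β^{v / (n + 1)!}` — again in `α^ℚ β^ℚ`
and `> 1`. Feed (2) at box-dimension `n + 1` with the enlarged box families (indexed by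
`Fin (k + m)` through `Fin.append`) and add back the simplex/box differences.

Sources: Kontsevich–Zagier 2001, §1.2 (soundness of the moves).
-/

noncomputable section

open MeasureTheory Set
open Literature.NumberTheory.Transcendental

namespace Summit.KontsevichZagierPeriods.SymplecticScissors.LogPolytope

/-! ## The corners of the box replacing a simplex -/

/-- The upper corners of the box replacing the simplex `{a_ι < x_ι, ∏ x_ι < c}` with
`c = (∏ a_ι) αᵘ βᵛ`: `a_ι · (g, …, g)[0 ↦ g ^ (1 / (n + 1)!)]_ι` with `g = c / ∏ a_ι = αᵘ βᵛ`,
i.e. edge ratios `α^{U} β^{V}` with `U = (u, …, u)[0 ↦ u / (n + 1)!]`,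
`V = (v, …, v)[0 ↦ v / (n + 1)!]`. [folklore] -/
theorem sxs_corner {n : ℕ} {α β tc : ℝ} {ta : Fin (n + 1) → ℝ} {tu tv : ℚ} (hα : 0 ≤ α)
    (hβ : 0 ≤ β) (hta : ∀ ι, 0 < ta ι)
    (htc : tc = (∏ ι, ta ι) * (α ^ ((tu : ℚ) : ℝ) * β ^ ((tv : ℚ) : ℝ))) (ι : Fin (n + 1)) :
    ta ι * Function.update (fun _ : Fin (n + 1) => tc / ∏ κ, ta κ) 0
        ((tc / ∏ κ, ta κ) ^ (((n + 1).factorial : ℝ)⁻¹)) ι =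
      ta ι * (α ^ ((Function.update (fun _ : Fin (n + 1) => tu) 0
          (tu / ((n + 1).factorial : ℚ)) ι : ℚ) : ℝ) *
        β ^ ((Function.update (fun _ : Fin (n + 1) => tv) 0
          (tv / ((n + 1).factorial : ℚ)) ι : ℚ) : ℝ)) := by
  have hP : (0 : ℝ) < ∏ κ, ta κ := Finset.prod_pos fun κ _ => hta κ
  have hg : tc / ∏ κ, ta κ = α ^ ((tu : ℚ) : ℝ) * β ^ ((tv : ℚ) : ℝ) := by
    rw [htc, mul_div_cancel_left₀ _ hP.ne']
  rcases eq_or_ne ι 0 with rfl | hι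
  · simp only [Function.update_self, hg, mxs_root_eq hα hβ]
  · simp only [Function.update_of_ne hι, hg]

/-- The box replacing a simplex, written with edge ratios `α^{U} β^{V}` (the shape of the box
sector) and written with the ratios `(g, …, g)[0 ↦ g ^ (1 / (n + 1)!)]`, `g = c / ∏ a_ι` (the
shape of `simplex ~ box`), is the same set. [folklore] -/
theorem sxs_box_eq {n : ℕ} {α β tc : ℝ} {ta : Fin (n + 1) → ℝ} {tu tv : ℚ} (hα : 0 ≤ α)
    (hβ : 0 ≤ β) (hta : ∀ ι, 0 < ta ι)
    (htc : tc = (∏ ι, ta ι) * (α ^ ((tu : ℚ) : ℝ) * β ^ ((tv : ℚ) : ℝ))) :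
    {p : Fin (n + 1 + 1) → ℝ | (∀ j : Fin (n + 1), ta j < p (Fin.castSucc j) ∧
        p (Fin.castSucc j) < ta j * (α ^ ((Function.update (fun _ : Fin (n + 1) => tu) 0
            (tu / ((n + 1).factorial : ℚ)) j : ℚ) : ℝ) *
          β ^ ((Function.update (fun _ : Fin (n + 1) => tv) 0
            (tv / ((n + 1).factorial : ℚ)) j : ℚ) : ℝ))) ∧
        0 < p (Fin.last (n + 1)) ∧
        p (Fin.last (n + 1)) * ∏ j : Fin (n + 1), p (Fin.castSucc j) < 1} =
      {p : Fin ((n + 1) + 1) → ℝ | (∀ ι : Fin (n + 1), (ta) ι < p (Fin.castSucc ι) ∧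
        p (Fin.castSucc ι) < ta ι * Function.update (fun _ : Fin (n + 1) => tc / ∏ κ, ta κ) 0
          ((tc / ∏ κ, ta κ) ^ (((n + 1).factorial : ℝ)⁻¹)) ι) ∧
        0 < p (Fin.last (n + 1)) ∧
        p (Fin.last (n + 1)) * ∏ ι : Fin (n + 1), p (Fin.castSucc ι) < 1} := by
  ext p
  simp only [Set.mem_setOf_eq, sxs_corner hα hβ hta htc]

/-! ## One side: replacing the simplices of a mixed family by boxes -/

/-- **One side of the mixed simplex/box sector.** Given `simplex ~ box` in box-dimension `n + 1`,
a mixed family of `k` log-boxes (position form, edge ratios `αᵘ βᵛ > 1`) and `m` log-simplices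
(`c = (∏ a_ι) αᵘ βᵛ`, ratio `> 1`) is, as a formal sum, KZ-equivalent to a family of `k + m`
log-boxes of the same shape with the same total value. [folklore] -/
theorem sxs_side {n : ℕ}
    (hSim : ∀ (a : Fin (n + 1) → ℝ) (c : ℝ), (∀ ι, 0 < a ι) → (∀ ι, IsAlgebraic ℚ (a ι)) →
      IsAlgebraic ℚ c → ∏ ι, a ι < c → ∀ (r r' : KZ.IntegralRep (n + 1 + 1)),
      r.domain = {p : Fin ((n + 1) + 1) → ℝ | (∀ ι : Fin (n + 1), (a) ι < p (Fin.castSucc ι)) ∧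
        ∏ ι : Fin (n + 1), p (Fin.castSucc ι) < c ∧ 0 < p (Fin.last (n + 1)) ∧
        p (Fin.last (n + 1)) * ∏ ι : Fin (n + 1), p (Fin.castSucc ι) < 1} →
      r'.domain = {p : Fin ((n + 1) + 1) → ℝ | (∀ ι : Fin (n + 1), (a) ι < p (Fin.castSucc ι) ∧
        p (Fin.castSucc ι) < (fun ι => a ι * Function.update (fun _ : Fin (n + 1) => c / ∏ κ, a κ)
          0 ((c / ∏ κ, a κ) ^ (((n + 1).factorial : ℝ)⁻¹)) ι) ι) ∧ 0 < p (Fin.last (n + 1)) ∧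
        p (Fin.last (n + 1)) * ∏ ι : Fin (n + 1), p (Fin.castSucc ι) < 1} →
      (∀ p ∈ r.domain, r.integrand p = 1) → (∀ p ∈ r'.domain, r'.integrand p = 1) →
      KZ.of r - KZ.of r' ∈ KZ.relations)
    {α β : ℝ} (hα : 0 < α) (hβ : 0 < β) (hαa : IsAlgebraic ℚ α) (hβa : IsAlgebraic ℚ β)
    {k m : ℕ} {a : Fin k → Fin (n + 1) → ℝ} {u v : Fin k → Fin (n + 1) → ℚ}
    {sa : Fin m → Fin (n + 1) → ℝ} {sc : Fin m → ℝ} {su sv : Fin m → ℚ}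
    {rB : Fin k → KZ.IntegralRep (n + 1 + 1)} {rS : Fin m → KZ.IntegralRep (n + 1 + 1)}
    (ha : ∀ i j, 0 < a i j) (haa : ∀ i j, IsAlgebraic ℚ (a i j))
    (hlt : ∀ i j, 1 < α ^ ((u i j : ℚ) : ℝ) * β ^ ((v i j : ℚ) : ℝ))
    (hrBd : ∀ i, (rB i).domain = {p : Fin (n + 1 + 1) → ℝ | (∀ j : Fin (n + 1),
      a i j < p (Fin.castSucc j) ∧
      p (Fin.castSucc j) < a i j * (α ^ ((u i j : ℚ) : ℝ) * β ^ ((v i j : ℚ) : ℝ))) ∧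
      0 < p (Fin.last (n + 1)) ∧ p (Fin.last (n + 1)) * ∏ j : Fin (n + 1), p (Fin.castSucc j) < 1})
    (hrBi : ∀ i, ∀ p ∈ (rB i).domain, (rB i).integrand p = 1)
    (hsa : ∀ ν ι, 0 < sa ν ι) (hsaa : ∀ ν ι, IsAlgebraic ℚ (sa ν ι))
    (hsca : ∀ ν, IsAlgebraic ℚ (sc ν))
    (hsc : ∀ ν, sc ν = (∏ ι, sa ν ι) * (α ^ ((su ν : ℚ) : ℝ) * β ^ ((sv ν : ℚ) : ℝ)))
    (hltS : ∀ ν, 1 < α ^ ((su ν : ℚ) : ℝ) * β ^ ((sv ν : ℚ) : ℝ))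
    (hrSd : ∀ ν, (rS ν).domain = {p : Fin ((n + 1) + 1) → ℝ |
      (∀ ι : Fin (n + 1), (sa ν) ι < p (Fin.castSucc ι)) ∧
      ∏ ι : Fin (n + 1), p (Fin.castSucc ι) < sc ν ∧ 0 < p (Fin.last (n + 1)) ∧
      p (Fin.last (n + 1)) * ∏ ι : Fin (n + 1), p (Fin.castSucc ι) < 1})
    (hrSi : ∀ ν, ∀ p ∈ (rS ν).domain, (rS ν).integrand p = 1) :
    ∃ (A : Fin (k + m) → Fin (n + 1) → ℝ) (U V : Fin (k + m) → Fin (n + 1) → ℚ)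
      (R : Fin (k + m) → KZ.IntegralRep (n + 1 + 1)),
      (∀ i j, 0 < A i j) ∧ (∀ i j, IsAlgebraic ℚ (A i j)) ∧
      (∀ i j, 1 < α ^ ((U i j : ℚ) : ℝ) * β ^ ((V i j : ℚ) : ℝ)) ∧
      (∀ i, (R i).domain = {p : Fin (n + 1 + 1) → ℝ | (∀ j : Fin (n + 1),
        A i j < p (Fin.castSucc j) ∧
        p (Fin.castSucc j) < A i j * (α ^ ((U i j : ℚ) : ℝ) * β ^ ((V i j : ℚ) : ℝ))) ∧
        0 < p (Fin.last (n + 1)) ∧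
        p (Fin.last (n + 1)) * ∏ j : Fin (n + 1), p (Fin.castSucc j) < 1}) ∧
      (∀ i, ∀ p ∈ (R i).domain, (R i).integrand p = 1) ∧
      ∑ i, (R i).value = ∑ ν, (rB ν).value + ∑ ν, (rS ν).value ∧
      ∑ i, KZ.of (R i) - (∑ ν, KZ.of (rB ν) + ∑ ν, KZ.of (rS ν)) ∈ KZ.relations := by
  have hcor : ∀ uu vv : ℚ, IsAlgebraic ℚ (α ^ ((uu : ℚ) : ℝ) * β ^ ((vv : ℚ) : ℝ)) :=
    fun uu vv => (mxs_rpow_isAlgebraic hα hαa uu).mul (mxs_rpow_isAlgebraic hβ hβa vv)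
  have hN : (0 : ℝ) < ((n + 1).factorial : ℝ) := Nat.cast_pos.mpr (Nat.factorial_pos _)
  -- the ratios `α^{U ν j} β^{V ν j}` of the replacement boxes exceed `1`
  have hSlt : ∀ ν, ∀ j : Fin (n + 1),
      1 < α ^ ((Function.update (fun _ : Fin (n + 1) => su ν) 0
          (su ν / ((n + 1).factorial : ℚ)) j : ℚ) : ℝ) *
        β ^ ((Function.update (fun _ : Fin (n + 1) => sv ν) 0
          (sv ν / ((n + 1).factorial : ℚ)) j : ℚ) : ℝ) := by
    intro ν j
    rcases eq_or_ne j 0 with rfl | hj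
    · simp only [Function.update_self]
      rw [mxs_root_eq hα.le hβ.le]
      exact Real.one_lt_rpow (hltS ν) (inv_pos.mpr hN)
    · simp only [Function.update_of_ne hj]
      exact hltS ν
  -- the replacement boxes
  have hexS : ∀ ν : Fin m, ∃ r : KZ.IntegralRep (n + 1 + 1),
      r.domain = {p : Fin (n + 1 + 1) → ℝ | (∀ j : Fin (n + 1), sa ν j < p (Fin.castSucc j) ∧
        p (Fin.castSucc j) < sa ν j *
          (α ^ ((Function.update (fun _ : Fin (n + 1) => su ν) 0
              (su ν / ((n + 1).factorial : ℚ)) j : ℚ) : ℝ) *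
            β ^ ((Function.update (fun _ : Fin (n + 1) => sv ν) 0
              (sv ν / ((n + 1).factorial : ℚ)) j : ℚ) : ℝ))) ∧
        0 < p (Fin.last (n + 1)) ∧
        p (Fin.last (n + 1)) * ∏ j : Fin (n + 1), p (Fin.castSucc j) < 1} ∧
      r.integrand = fun _ => 1 := fun ν =>
    stub_logBoxCut.1 (n + 1) (sa ν) (fun j => sa ν j *
      (α ^ ((Function.update (fun _ : Fin (n + 1) => su ν) 0
          (su ν / ((n + 1).factorial : ℚ)) j : ℚ) : ℝ) *
        β ^ ((Function.update (fun _ : Fin (n + 1) => sv ν) 0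
          (sv ν / ((n + 1).factorial : ℚ)) j : ℚ) : ℝ)))
      (hsa ν) (hsaa ν) (fun j => (hsaa ν j).mul (hcor _ _))
  choose bS hbSd hbSi using hexS
  have hbSi' : ∀ ν, ∀ p ∈ (bS ν).domain, (bS ν).integrand p = 1 := fun ν p _ => by
    rw [hbSi ν]
  -- `simplex ~ box`, and equality of values by soundness of the calculus
  have hSB : ∀ ν, KZ.of (rS ν) - KZ.of (bS ν) ∈ KZ.relations := fun ν => by
    have hP : (0 : ℝ) < ∏ ι, sa ν ι := Finset.prod_pos fun ι _ => hsa ν ι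
    refine hSim (sa ν) (sc ν) (hsa ν) (hsaa ν) (hsca ν) ?_ (rS ν) (bS ν) (hrSd ν) ?_ (hrSi ν)
      (hbSi' ν)
    · rw [hsc ν]
      exact lt_mul_of_one_lt_right hP (hltS ν)
    · rw [hbSd ν]
      exact sxs_box_eq hα.le hβ.le (hsa ν) (hsc ν)
  have hval : ∀ ν, (bS ν).value = (rS ν).value := fun ν =>
    (KZ.Equivalent.value_eq_holds (hSB ν)).symm
  -- the enlarged box family
  refine ⟨Fin.append a sa,
    Fin.append u (fun ν => Function.update (fun _ : Fin (n + 1) => su ν) 0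
      (su ν / ((n + 1).factorial : ℚ))),
    Fin.append v (fun ν => Function.update (fun _ : Fin (n + 1) => sv ν) 0
      (sv ν / ((n + 1).factorial : ℚ))),
    Fin.append rB bS, ?_, ?_, ?_, ?_, ?_, ?_, ?_⟩
  · intro i
    induction i using Fin.addCases with
    | left i => simp only [Fin.append_left]; exact ha i
    | right ν => simp only [Fin.append_right]; exact hsa ν
  · intro i
    induction i using Fin.addCases with
    | left i => simp only [Fin.append_left]; exact haa i
    | right ν => simp only [Fin.append_right]; exact hsaa ν
  · intro i
    induction i using Fin.addCases with
    | left i => simp only [Fin.append_left]; exact hlt i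
    | right ν => simp only [Fin.append_right]; exact hSlt ν
  · intro i
    induction i using Fin.addCases with
    | left i => simp only [Fin.append_left]; exact hrBd i
    | right ν => simp only [Fin.append_right]; exact hbSd ν
  · intro i
    induction i using Fin.addCases with
    | left i => simp only [Fin.append_left]; exact hrBi i
    | right ν => simp only [Fin.append_right]; exact hbSi' ν
  · simp only [Fin.sum_univ_add, Fin.append_left, Fin.append_right, hval]
  · rw [Fin.sum_univ_add]
    simp only [Fin.append_left, Fin.append_right]
    have : ∑ i, KZ.of (rB i) + ∑ ν, KZ.of (bS ν) - (∑ ν, KZ.of (rB ν) + ∑ ν, KZ.of (rS ν)) =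
        ∑ ν, (KZ.of (bS ν) - KZ.of (rS ν)) := by
      rw [Finset.sum_sub_distrib]; abel
    rw [this]
    exact sum_mem fun ν _ => by rw [← neg_sub]; exact KZ.relations.neg_mem (hSB ν)

/-! ## The stub -/

/-- **Stub (the mixed simplex/box sector in every dimension, bookkeeping).** Given
`stub_simplexToBox`'s conclusion and the landed position-form box sector: for `α, β > 0` real
algebraic and multiplicatively independent, two mixed finite families of log-boxes (real-algebraic
position, edge ratios in `α^ℚ β^ℚ`, `> 1`) and log-simplices (`c = (∏ a_ι) · α^u β^v`, `u, v ∈ ℚ`,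
ratio `> 1`) in dimension `n + 2` with equal total value are KZ-equivalent as formal sums (replace
every simplex by its box — values are preserved by soundness — and apply the box sector to the
enlarged box families). [folklore] -/
theorem stub_simplexSector : (∀ (n : ℕ) (a : Fin (n + 1) → ℝ) (c : ℝ), (∀ ι, 0 < a ι) → (∀ ι, IsAlgebraic ℚ (a ι)) → IsAlgebraic ℚ c → ∏ ι, a ι < c → ∀ (r r' : KZ.IntegralRep (n + 1 + 1)), r.domain = {p : Fin ((n + 1) + 1) → ℝ | (∀ ι : Fin (n + 1), (a) ι < p (Fin.castSucc ι)) ∧ ∏ ι : Fin (n + 1), p (Fin.castSucc ι) < c ∧ 0 < p (Fin.last (n + 1)) ∧ p (Fin.last (n + 1)) * ∏ ι : Fin (n + 1), p (Fin.castSucc ι) < 1} → r'.domain = {p : Fin ((n + 1) + 1) → ℝ | (∀ ι : Fin (n + 1), (a) ι < p (Fin.castSucc ι) ∧ p (Fin.castSucc ι) < (fun ι => a ι * Function.update (fun _ : Fin (n + 1) => c / ∏ κ, a κ) 0 ((c / ∏ κ, a κ) ^ (((n + 1).factorial : ℝ)⁻¹)) ι) ι) ∧ 0 < p (Fin.last (n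 + 1)) ∧ p (Fin.last (n + 1)) * ∏ ι : Fin (n + 1), p (Fin.castSucc ι) < 1} → (∀ p ∈ r.domain, r.integrand p = 1) → (∀ p ∈ r'.domain, r'.integrand p = 1) → KZ.of r - KZ.of r' ∈ KZ.relations) → (∀ (n : ℕ) (α β : ℝ), 0 < α → 0 < β → IsAlgebraic ℚ α → IsAlgebraic ℚ β → (∀ p q : ℤ, α ^ p * β ^ q = 1 → p = 0 ∧ q = 0) → ∀ (k k' : ℕ) (a : Fin k → Fin n → ℝ) (u v : Fin k → Fin n → ℚ) (a' : Fin k' → Fin n → ℝ) (s t : Fin k' → Fin n → ℚ) (r : Fin k → KZ.IntegralRep (n + 1)) (r' : Fin k' → KZ.IntegralRep (n + 1)), (∀ i j, 0 < a i j) → (∀ i j, IsAlgebraic ℚ (a i j)) → (∀ i j, 1 < α ^ ((u i j : ℚ) : ℝ) * β ^ ((v i j : ℚ) : ℝ)) → (∀ i j, 0 < a' i j) → (∀ i j, IsAlgebraic ℚ (a' i j)) → (∀ i j, 1 < α ^ ((s i j : ℚ) : ℝ) * β ^ ((t i j : ℚ) : ℝ)) → (∀ i, (r i).domain = {p : Fin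 (n + 1) → ℝ | (∀ j : Fin n, a i j < p (Fin.castSucc j) ∧ p (Fin.castSucc j) < a i j * (α ^ ((u i j : ℚ) : ℝ) * β ^ ((v i j : ℚ) : ℝ))) ∧ 0 < p (Fin.last n) ∧ p (Fin.last n) * ∏ j : Fin n, p (Fin.castSucc j) < 1}) → (∀ i, ∀ p ∈ (r i).domain, (r i).integrand p = 1) → (∀ i, (r' i).domain = {p : Fin (n + 1) → ℝ | (∀ j : Fin n, a' i j < p (Fin.castSucc j) ∧ p (Fin.castSucc j) < a' i j * (α ^ ((s i j : ℚ) : ℝ) * β ^ ((t i j : ℚ) : ℝ))) ∧ 0 < p (Fin.last n) ∧ p (Fin.last n) * ∏ j : Fin n, p (Fin.castSucc j) < 1}) → (∀ i, ∀ p ∈ (r' i).domain, (r' i).integrand p = 1) → ∑ i, (r i).value = ∑ i, (r' i).value → ∑ i, KZ.of (r i) - ∑ i, KZ.of (r' i) ∈ KZ.relations) → (∀ (n : ℕ) (α β : ℝ), 0 < α → 0 < β → IsAlgebraic ℚ α → IsAlgebraic ℚ β → (∀ p q : ℤ, α ^ p * β ^ q = 1 → p = 0 ∧ q = 0) → ∀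 (k m k' m' : ℕ) (a : Fin k → Fin (n + 1) → ℝ) (u v : Fin k → Fin (n + 1) → ℚ) (sa : Fin m → Fin (n + 1) → ℝ) (sc : Fin m → ℝ) (su sv : Fin m → ℚ) (a' : Fin k' → Fin (n + 1) → ℝ) (u' v' : Fin k' → Fin (n + 1) → ℚ) (sa' : Fin m' → Fin (n + 1) → ℝ) (sc' : Fin m' → ℝ) (su' sv' : Fin m' → ℚ) (rB : Fin k → KZ.IntegralRep (n + 1 + 1)) (rS : Fin m → KZ.IntegralRep (n + 1 + 1)) (rB' : Fin k' → KZ.IntegralRep (n + 1 + 1)) (rS' : Fin m' → KZ.IntegralRep (n + 1 + 1)), (∀ i j, 0 < a i j) → (∀ i j, IsAlgebraic ℚ (a i j)) → (∀ i j, 1 < α ^ ((u i j : ℚ) : ℝ) * β ^ ((v i j : ℚ) : ℝ)) → (∀ i, (rB i).domain = {p : Fin (n + 1 + 1) → ℝ | (∀ j : Fin (n + 1), a i j < p (Fin.castSucc j) ∧ p (Fin.castSucc j) < a i j * (α ^ ((u i j : ℚ) : ℝ) * β ^ ((v i j : ℚ) : ℝ))) ∧ 0 < p (Fin.last (n + 1))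 ∧ p (Fin.last (n + 1)) * ∏ j : Fin (n + 1), p (Fin.castSucc j) < 1}) → (∀ i, ∀ p ∈ (rB i).domain, (rB i).integrand p = 1) → (∀ ν ι, 0 < sa ν ι) → (∀ ν ι, IsAlgebraic ℚ (sa ν ι)) → (∀ ν, IsAlgebraic ℚ (sc ν)) → (∀ ν, sc ν = (∏ ι, sa ν ι) * (α ^ ((su ν : ℚ) : ℝ) * β ^ ((sv ν : ℚ) : ℝ))) → (∀ ν, 1 < α ^ ((su ν : ℚ) : ℝ) * β ^ ((sv ν : ℚ) : ℝ)) → (∀ ν, (rS ν).domain = {p : Fin ((n + 1) + 1) → ℝ | (∀ ι : Fin (n + 1), (sa ν) ι < p (Fin.castSucc ι)) ∧ ∏ ι : Fin (n + 1), p (Fin.castSucc ι) < sc ν ∧ 0 < p (Fin.last (n + 1)) ∧ p (Fin.last (n + 1)) * ∏ ι : Fin (n + 1), p (Fin.castSucc ι) < 1}) → (∀ ν, ∀ p ∈ (rS ν).domain, (rS ν).integrand p = 1) → (∀ i j, 0 < a' i j) → (∀ i j, IsAlgebraic ℚ (a' i j)) → (∀ i j, 1 < α ^ ((u' i j : ℚ)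 : ℝ) * β ^ ((v' i j : ℚ) : ℝ)) → (∀ i, (rB' i).domain = {p : Fin (n + 1 + 1) → ℝ | (∀ j : Fin (n + 1), a' i j < p (Fin.castSucc j) ∧ p (Fin.castSucc j) < a' i j * (α ^ ((u' i j : ℚ) : ℝ) * β ^ ((v' i j : ℚ) : ℝ))) ∧ 0 < p (Fin.last (n + 1)) ∧ p (Fin.last (n + 1)) * ∏ j : Fin (n + 1), p (Fin.castSucc j) < 1}) → (∀ i, ∀ p ∈ (rB' i).domain, (rB' i).integrand p = 1) → (∀ ν ι, 0 < sa' ν ι) → (∀ ν ι, IsAlgebraic ℚ (sa' ν ι)) → (∀ ν, IsAlgebraic ℚ (sc' ν)) → (∀ ν, sc' ν = (∏ ι, sa' ν ι) * (α ^ ((su' ν : ℚ) : ℝ) * β ^ ((sv' ν : ℚ) : ℝ))) → (∀ ν, 1 < α ^ ((su' ν : ℚ) : ℝ) * β ^ ((sv' ν : ℚ) : ℝ)) → (∀ ν, (rS' ν).domain = {p : Fin ((n + 1) + 1) → ℝ | (∀ ι : Fin (n + 1), (sa' ν) ι < p (Fin.castSucc ι)) ∧ ∏ ι : Fin (n + 1),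 p (Fin.castSucc ι) < sc' ν ∧ 0 < p (Fin.last (n + 1)) ∧ p (Fin.last (n + 1)) * ∏ ι : Fin (n + 1), p (Fin.castSucc ι) < 1}) → (∀ ν, ∀ p ∈ (rS' ν).domain, (rS' ν).integrand p = 1) → ∑ ν, (rB ν).value + ∑ ν, (rS ν).value = ∑ ν, (rB' ν).value + ∑ ν, (rS' ν).value → (∑ ν, KZ.of (rB ν) + ∑ ν, KZ.of (rS ν)) - (∑ ν, KZ.of (rB' ν) + ∑ ν, KZ.of (rS' ν)) ∈ KZ.relations) := by
  intro hSim hPos n α β hα hβ hαa hβa hind k m k' m' a u v sa sc su sv a' u' v' sa' sc' su' sv' rB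
    rS rB' rS' ha haa hlt hrBd hrBi hsa hsaa hsca hsc hltS hrSd hrSi ha' ha'a hlt' hrB'd hrB'i hsa'
    hsa'a hsc'a hsc' hltS' hrS'd hrS'i hv
  obtain ⟨A, U, V, R, hA, hAa, hAlt, hRd, hRi, hRv, hRrel⟩ := sxs_side (hSim n) hα hβ hαa hβa ha
    haa hlt hrBd hrBi hsa hsaa hsca hsc hltS hrSd hrSi
  obtain ⟨A', U', V', R', hA', hA'a, hA'lt, hR'd, hR'i, hR'v, hR'rel⟩ := sxs_side (hSim n) hα hβ
    hαa hβa ha' ha'a hlt' hrB'd hrB'i hsa' hsa'a hsc'a hsc' hltS' hrS'd hrS'i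
  have hout : ∑ i, KZ.of (R i) - ∑ i, KZ.of (R' i) ∈ KZ.relations :=
    hPos (n + 1) α β hα hβ hαa hβa hind (k + m) (k' + m') A U V A' U' V' R R' hA hAa hAlt hA' hA'a
      hA'lt hRd hRi hR'd hR'i (by rw [hRv, hR'v]; exact hv)
  have key : (∑ ν, KZ.of (rB ν) + ∑ ν, KZ.of (rS ν)) - (∑ ν, KZ.of (rB' ν) + ∑ ν, KZ.of (rS' ν)) =
      (∑ i, KZ.of (R i) - ∑ i, KZ.of (R' i)) -
        (∑ i, KZ.of (R i) - (∑ ν, KZ.of (rB ν) + ∑ ν, KZ.of (rS ν))) +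
        (∑ i, KZ.of (R' i) - (∑ ν, KZ.of (rB' ν) + ∑ ν, KZ.of (rS' ν))) := by
    abel
  rw [key]
  exact KZ.relations.add_mem (KZ.relations.sub_mem hout hRrel) hR'rel

end Summit.KontsevichZagierPeriods.SymplecticScissors.LogPolytope

end
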